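import Mathlib
import Summits.MatrixMultiplication.MatrixMultiplication.Theses.MatrixPointInterpolation
import Summits.MatrixMultiplication.MatrixMultiplication.Theorems.LongMasquerade.Negative.WindowedKaplanskyTwo
import Literature.Algebra.PolynomialIdentities.CentralPolynomialsMatrix
import Literature.Algebra.PolynomialIdentities.GenericMatricesGrowth

/-!
# `MatrixPointInterpolation.TightWindows` (stmt-MatrixMultiplication-18939) — Negative lane:
# every masquerade is loose, part 1 (the anti-Riemann–Roch inequality)

Port to the tree of the crux-strategist's negation-lens file
`Cruxes/TightWindows/LooseMasquerades.lean` (planner-cstrat-stmt-MatrixMultiplication-18939-b1-0,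
2026-08-17; kernel-checked there), by the crux disprover, now that its literature inputs are vendored
(`Literature.Algebra.PolynomialIdentities.{CentralPolynomialsMatrix, GenericMatricesGrowth}`).
This part (no new definitions — local notation over the vendored vocabulary `matEval`,
`IsMatrixIdentity`, `MonoidAlgebra.supported`): two-letter polynomials `NCP`, evaluation `evM`,
the degree filtration `Pd⟦D⟧`, identities `IsId`, the word-function map `evF⟦k⟧` (the image of
`Pd⟦D⟧` has dimension `genericWordDim k D`, the quantity bounded by the crux), the window in
polynomial form, and the
**anti-Riemann–Roch inequality** `finrank_add_wordDim_le`: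

if `z ∈ Pd g` is central modulo the identities of `M_k` and multiplication by `z - ζ` reflects
identities for every scalar `ζ`, then at a pair `A` generating `M_n` in degree `d` and masquerading
as `M_k` to degree `2d` one has, for `g ≤ j ≤ 2d`,

    dim span{w(A) : |w| ≤ j} + genericWordDim k (j - g) ≤ genericWordDim k j,

because `z(A)` is a scalar `ζ` (it commutes with the generators inside the window), so evaluation
at `A` kills `(z - ζ)·Pd (j - g)` on top of the identities, and `(z - ζ)·` reflects identities.
Part 2 (`LooseMasquerades.lean`, same directory) turns this into `LongMasquerade → ¬ TightWindows`.
-/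

namespace Summit.MatrixMultiplication.MatrixMultiplication.Theorems

namespace TightWindowsLoose

open scoped BigOperators
open Matrix
open Literature.Algebra.PolynomialIdentities

/-! ## Local notation: two-letter polynomials, evaluation, degree filtration, identities

(`local notation`, so that this negative-lane file declares no new definitions; the vocabulary is
the vendored one of `Literature.Algebra.PolynomialIdentities`.) -/

set_option quotPrecheck false

/-- Words in the two letters `0, 1` (local notation). [folklore] -/
local notation "Wd" => FreeMonoid (Fin 2)
/-- Non-commutative polynomials `ℂ⟨x₀, x₁⟩` = the monoid algebra of the free monoid (local notation).
[folklore] -/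
local notation "NCP" => MonoidAlgebra ℂ (FreeMonoid (Fin 2))
/-- Evaluation at a pair of matrices: the vendored `matEval` (local notation). [folklore] -/
local notation "evM" => Literature.Algebra.PolynomialIdentities.matEval
/-- The degree filtration `Pd⟦D⟧`: polynomials supported on words of length `≤ D` (local notation).
[folklore] -/
local notation:max "Pd⟦" D "⟧" =>
  (MonoidAlgebra.supported ℂ ℂ (setOf fun w : FreeMonoid (Fin 2) => (FreeMonoid.toList w).length ≤ D) :
    Submodule ℂ (MonoidAlgebra ℂ (FreeMonoid (Fin 2))))
/-- Identities of `M_k(ℂ)`: the vendored `IsMatrixIdentity` (local notation). [folklore] -/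
local notation "IsId" => Literature.Algebra.PolynomialIdentities.IsMatrixIdentity
/-- `evF⟦k⟧`: evaluation as a linear map into functions on pairs of `k × k` matrices (local
notation). [folklore] -/
local notation:max "evF⟦" k "⟧" =>
  (LinearMap.pi fun B : (Fin 2 → Matrix (Fin k) (Fin k) ℂ) =>
    (Literature.Algebra.PolynomialIdentities.matEval B).toLinearMap :
    MonoidAlgebra ℂ (FreeMonoid (Fin 2)) →ₗ[ℂ] ((Fin 2 → Matrix (Fin k) (Fin k) ℂ) → Matrix (Fin k) (Fin k) ℂ))





/-! ## Words, evaluation -/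

/-- Evaluation of a monomial `c·w` at `B`: `c • w(B)`. [folklore] -/
theorem evM_single {m : ℕ} (B : Fin 2 → Matrix (Fin m) (Fin m) ℂ) (w : Wd) (c : ℂ) :
    evM B (MonoidAlgebra.single w c) = c • (w.toList.map B).prod := by
  rw [Literature.Algebra.PolynomialIdentities.matEval_single, FreeMonoid.lift_apply]

/-- Evaluation of a letter is the corresponding matrix. [folklore] -/
theorem evM_of {m : ℕ} (B : Fin 2 → Matrix (Fin m) (Fin m) ℂ) (i : Fin 2) :
    evM B (MonoidAlgebra.single (FreeMonoid.of i) 1) = B i := by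
  rw [evM_single, one_smul, FreeMonoid.toList_of, List.map_singleton, List.prod_singleton]

/-- Evaluation as a finite sum over the support. [folklore] -/
theorem evM_apply {m : ℕ} (B : Fin 2 → Matrix (Fin m) (Fin m) ℂ) (p : NCP) :
    evM B p = ∑ w ∈ p.coeff.support, p.coeff w • (w.toList.map B).prod := by
  rw [Literature.Algebra.PolynomialIdentities.matEval, MonoidAlgebra.lift_apply, Finsupp.sum]
  simp only [FreeMonoid.lift_apply]

/-! ## The degree filtration -/

/-- Membership in the degree filtration: every word of the support has length `≤ D`. [folklore] -/
theorem mem_Pd {D : ℕ} {p : NCP} : p ∈ Pd⟦D⟧ ↔ ∀ w ∈ p.coeff.support, w.toList.length ≤ D := by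
  rw [MonoidAlgebra.mem_supported]
  exact Iff.rfl

/-- The degree filtration is increasing. [folklore] -/
theorem Pd_mono {a b : ℕ} (h : a ≤ b) : Pd⟦a⟧ ≤ Pd⟦b⟧ :=
  MonoidAlgebra.supported_mono fun w (hw : w.toList.length ≤ a) => le_trans hw h

/-- There are finitely many words of length `≤ D` in two letters. [folklore] -/
theorem finite_words (D : ℕ) : {w : Wd | w.toList.length ≤ D}.Finite :=
  List.finite_length_le (Fin 2) D

/-- Each filtration piece `Pd⟦D⟧` is finite-dimensional (use via `haveI`). [folklore] -/
theorem finiteDimensional_Pd (D : ℕ) : FiniteDimensional ℂ (Pd⟦D⟧) := by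
  haveI : Finite {w : Wd | w.toList.length ≤ D} := (finite_words D).to_subtype
  exact LinearEquiv.finiteDimensional
    (MonoidAlgebra.supportedEquivFinsupp (R := ℂ) (S := ℂ) {w : Wd | w.toList.length ≤ D}).symm

/-- A monomial on a word of length `≤ D` lies in `Pd⟦D⟧`. [folklore] -/
theorem single_mem_Pd {D : ℕ} {w : Wd} (hw : w.toList.length ≤ D) (c : ℂ) :
    MonoidAlgebra.single w c ∈ Pd⟦D⟧ := by
  rw [mem_Pd]
  intro w' hw'
  rw [MonoidAlgebra.coeff_single] at hw'
  have : w' = w := by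
    by_contra h
    rw [Finsupp.mem_support_iff, Finsupp.single_eq_of_ne h] at hw'
    exact hw' rfl
  rw [this]; exact hw

/-- Scalars lie in every `Pd⟦D⟧`. [folklore] -/
theorem algebraMap_mem_Pd (c : ℂ) (D : ℕ) : algebraMap ℂ NCP c ∈ Pd⟦D⟧ := by
  rw [MonoidAlgebra.coe_algebraMap, Function.comp_apply]
  exact single_mem_Pd (by simp) _

/-- `Pd⟦a⟧ · Pd⟦b⟧ ⊆ Pd⟦a + b⟧`. [folklore] -/
theorem mul_mem_Pd {a b : ℕ} {p q : NCP} (hp : p ∈ Pd⟦a⟧) (hq : q ∈ Pd⟦b⟧) : p * q ∈ Pd⟦a + b⟧ := by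
  classical
  rw [mem_Pd] at hp hq ⊢
  intro w hw
  have := MonoidAlgebra.support_coeff_mul_subset p q hw
  rw [Finset.mem_mul] at this
  obtain ⟨u, hu, v, hv, rfl⟩ := this
  rw [FreeMonoid.toList_mul, List.length_append]
  exact Nat.add_le_add (hp u hu) (hq v hv)

/-! ## Identities of `M_k` and the word-function space -/

/-- Unfolding `evF`. [folklore] -/
theorem evF_apply (k : ℕ) (p : NCP) (B : Fin 2 → Matrix (Fin k) (Fin k) ℂ) : evF⟦k⟧ p B = evM B p := rfl

/-- The kernel of `evF⟦k⟧` is the space of identities of `M_k`. [folklore] -/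
theorem mem_ker_evF {k : ℕ} {p : NCP} : p ∈ LinearMap.ker (evF⟦k⟧) ↔ IsId k p := by
  rw [LinearMap.mem_ker]
  constructor
  · intro h B; exact congrFun h B
  · intro h; funext B; exact h B

/-- `Pd⟦D⟧` is spanned by the monomials on words of length `≤ D`. [folklore] -/
theorem Pd_eq_span (D : ℕ) :
    Pd⟦D⟧ = Submodule.span ℂ ((fun w => MonoidAlgebra.single w (1 : ℂ)) '' {w : Wd | w.toList.length ≤ D}) := by
  rw [MonoidAlgebra.supported_eq_span_single]

/-- The image of `Pd⟦D⟧` under `evF⟦k⟧` is the span of the word-functions of length `≤ D` (verbatim the set in the conclusion of `TightWindows`). [folklore] -/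
theorem map_evF_Pd (k D : ℕ) :
    (Pd⟦D⟧).map (evF⟦k⟧) = Submodule.span ℂ {f : (Fin 2 → Matrix (Fin k) (Fin k) ℂ) →
      Matrix (Fin k) (Fin k) ℂ | ∃ w : List (Fin 2), w.length ≤ D ∧ f = fun B => (w.map B).prod} := by
  rw [Pd_eq_span, Submodule.map_span]
  congr 1
  ext f
  simp only [Set.mem_image, Set.mem_setOf_eq]
  constructor
  · rintro ⟨p, ⟨w, hw, rfl⟩, rfl⟩
    refine ⟨w.toList, hw, ?_⟩
    funext B
    rw [evF_apply, evM_single, one_smul]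
  · rintro ⟨w, hw, rfl⟩
    refine ⟨MonoidAlgebra.single (FreeMonoid.ofList w) 1, ⟨FreeMonoid.ofList w, by simpa using hw, rfl⟩, ?_⟩
    funext B
    rw [evF_apply, evM_single, one_smul, FreeMonoid.toList_ofList]

/-- `genericWordDim k D` is the dimension of the image of `Pd⟦D⟧` under `evF⟦k⟧`. [folklore] -/
theorem wordDim_eq (k D : ℕ) : genericWordDim k D = Module.finrank ℂ ((Pd⟦D⟧).map (evF⟦k⟧)) := by
  rw [Literature.Algebra.PolynomialIdentities.genericWordDim, map_evF_Pd]

/-- The image of `Pd⟦j⟧` under evaluation at `A` is the span `V_j` of the words of length `≤ j` at `A` (verbatim the set in the generation hypothesis). [folklore] -/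
theorem map_evM_Pd {n : ℕ} (A : Fin 2 → Matrix (Fin n) (Fin n) ℂ) (j : ℕ) :
    (Pd⟦j⟧).map (evM A).toLinearMap = Submodule.span ℂ {M : Matrix (Fin n) (Fin n) ℂ |
      ∃ w : List (Fin 2), w.length ≤ j ∧ (w.map A).prod = M} := by
  rw [Pd_eq_span, Submodule.map_span]
  congr 1
  ext M
  simp only [Set.mem_image, Set.mem_setOf_eq]
  constructor
  · rintro ⟨p, ⟨w, hw, rfl⟩, rfl⟩
    exact ⟨w.toList, hw, by rw [AlgHom.toLinearMap_apply, evM_single, one_smul]⟩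
  · rintro ⟨w, hw, rfl⟩
    refine ⟨MonoidAlgebra.single (FreeMonoid.ofList w) 1, ⟨FreeMonoid.ofList w, by simpa using hw, rfl⟩, ?_⟩
    rw [AlgHom.toLinearMap_apply, evM_single, one_smul, FreeMonoid.toList_ofList]

/-! ## The window in polynomial form -/

/-- From the route's window hypothesis (finite sums of words) to the polynomial form: an identity
of `M_k` supported in degree `≤ 2d` vanishes at `A`. [folklore] -/
theorem window_poly {n k d : ℕ} {A : Fin 2 → Matrix (Fin n) (Fin n) ℂ}
    (hwin : ∀ (T : Finset (List (Fin 2))) (c : List (Fin 2) → ℂ), (∀ w ∈ T, w.length ≤ 2 * d) →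
      (∀ B : Fin 2 → Matrix (Fin k) (Fin k) ℂ, (∑ w ∈ T, c w • (w.map B).prod) = 0) →
      (∑ w ∈ T, c w • (w.map A).prod) = 0)
    {p : NCP} (hp : p ∈ Pd⟦2 * d⟧) (hid : IsId k p) : evM A p = 0 := by
  classical
  have key : ∀ {m : ℕ} (X : Fin 2 → Matrix (Fin m) (Fin m) ℂ),
      (∑ w ∈ p.coeff.support.image FreeMonoid.toList,
        (fun w : List (Fin 2) => p.coeff (FreeMonoid.ofList w)) w • (w.map X).prod) = evM X p := by
    intro m X
    rw [Finset.sum_image (fun u _ v _ h => FreeMonoid.toList.injective h), evM_apply]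
    simp only [FreeMonoid.ofList_toList]
  rw [← key A]
  apply hwin
  · intro w hw
    rw [Finset.mem_image] at hw
    obtain ⟨u, hu, rfl⟩ := hw
    exact (mem_Pd.1 hp) u hu
  · intro B
    rw [key B]
    exact hid B

/-! ## Central elements evaluate to scalars at a masquerade -/

/-- The commutator of `z ∈ Pd⟦g⟧` with a letter lies in `Pd⟦g + 1⟧`. [folklore] -/
theorem commutator_mem_Pd {g : ℕ} {z : NCP} (hz : z ∈ Pd⟦g⟧) (i : Fin 2) :
    z * MonoidAlgebra.single (FreeMonoid.of i) 1 - MonoidAlgebra.single (FreeMonoid.of i) 1 * z ∈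
      Pd⟦g + 1⟧ := by
  have h1 : MonoidAlgebra.single (FreeMonoid.of i) (1 : ℂ) ∈ Pd⟦1⟧ := single_mem_Pd (by simp) 1
  refine Submodule.sub_mem _ (mul_mem_Pd hz h1) ?_
  have := mul_mem_Pd h1 hz
  rwa [add_comm] at this

/-- A polynomial that is central modulo the identities of `M_k`, of degree `g` with `g + 1 ≤ 2d`,
evaluates to a scalar matrix at any pair generating `M_n` whose window to degree `2d` holds. [folklore] -/
theorem eval_central_eq_smul_one {n k d g : ℕ} {A : Fin 2 → Matrix (Fin n) (Fin n) ℂ}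
    (hspan : Submodule.span ℂ {M : Matrix (Fin n) (Fin n) ℂ |
      ∃ w : List (Fin 2), w.length ≤ d ∧ (w.map A).prod = M} = ⊤)
    (hwin : ∀ (T : Finset (List (Fin 2))) (c : List (Fin 2) → ℂ), (∀ w ∈ T, w.length ≤ 2 * d) →
      (∀ B : Fin 2 → Matrix (Fin k) (Fin k) ℂ, (∑ w ∈ T, c w • (w.map B).prod) = 0) →
      (∑ w ∈ T, c w • (w.map A).prod) = 0)
    {z : NCP} (hz : z ∈ Pd⟦g⟧) (hgd : g + 1 ≤ 2 * d)
    (hzc : ∀ (B : Fin 2 → Matrix (Fin k) (Fin k) ℂ) (i : Fin 2), evM B z * B i = B i * evM B z) :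
    ∃ ζ : ℂ, evM A z = ζ • 1 := by
  refine Summit.MatrixMultiplication.MatrixMultiplication.Theorems.LongMasqueradeNeg.scalar_of_commute_gens
    hspan fun i => ?_
  have hp : z * MonoidAlgebra.single (FreeMonoid.of i) 1 - MonoidAlgebra.single (FreeMonoid.of i) 1 * z ∈
      Pd⟦2 * d⟧ := Pd_mono hgd (commutator_mem_Pd hz i)
  have hid : IsId k (z * MonoidAlgebra.single (FreeMonoid.of i) 1 -
      MonoidAlgebra.single (FreeMonoid.of i) 1 * z) := by
    intro B
    rw [map_sub, map_mul, map_mul, evM_of, hzc B i, sub_self]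
  have h := window_poly hwin hp hid
  rw [map_sub, map_mul, map_mul, evM_of] at h
  exact sub_eq_zero.1 h

/-! ## Small linear-algebra helpers -/

/-- `evF⟦k⟧ p = 0` iff `p` is an identity of `M_k`. [folklore] -/
theorem evF_eq_zero_iff {k : ℕ} {p : NCP} : evF⟦k⟧ p = 0 ↔ IsId k p := by
  constructor
  · intro h B; exact congrFun h B
  · intro h; funext B; exact h B

/-- The range of a restricted linear map is the image of the submodule. [folklore] -/
theorem range_domRestrict_eq_map {R M M₂ : Type*} [Semiring R] [AddCommMonoid M] [AddCommMonoid M₂]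
    [Module R M] [Module R M₂] (f : M →ₗ[R] M₂) (p : Submodule R M) :
    LinearMap.range (f.domRestrict p) = p.map f := by
  ext x
  simp only [LinearMap.mem_range, LinearMap.domRestrict_apply, Submodule.mem_map, Subtype.exists,
    exists_prop]

/-! ## The anti-Riemann–Roch inequality

If `z` is central modulo the identities of `M_k`, homogeneous-free of degree `≤ g` (only the degree
bound is used) and *regular* modulo the identities (multiplication by `z - ζ` reflects identities),
then at a masquerade `A` of `M_k` to degree `2d` generating `M_n` in degree `d` the span `V_j` of
the words of length `≤ j` satisfies `dim V_j + wordDim k (j - g) ≤ wordDim k j` for `g ≤ j ≤ 2d`: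
the evaluation map factors through the word functions and kills `(z - ζ)·(words of length ≤ j-g)`. -/
/-- **The anti-Riemann–Roch inequality.**  At a pair `A` generating `M_n` in degree `d` and
masquerading as `M_k` to degree `2d`, for a central (`hzc`), regular (`hreg`) two-letter `z ∈ Pd⟦g⟧`
with `g + 1 ≤ 2d` and `g ≤ j ≤ 2d`:
`dim span{w(A) : |w| ≤ j} + genericWordDim k (j - g) ≤ genericWordDim k j`. [folklore] -/
theorem finrank_add_wordDim_le {n k d g : ℕ} {A : Fin 2 → Matrix (Fin n) (Fin n) ℂ}
    (hspan : Submodule.span ℂ {M : Matrix (Fin n) (Fin n) ℂ |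
      ∃ w : List (Fin 2), w.length ≤ d ∧ (w.map A).prod = M} = ⊤)
    (hwin : ∀ (T : Finset (List (Fin 2))) (c : List (Fin 2) → ℂ), (∀ w ∈ T, w.length ≤ 2 * d) →
      (∀ B : Fin 2 → Matrix (Fin k) (Fin k) ℂ, (∑ w ∈ T, c w • (w.map B).prod) = 0) →
      (∑ w ∈ T, c w • (w.map A).prod) = 0)
    {z : NCP} (hz : z ∈ Pd⟦g⟧) (hgd : g + 1 ≤ 2 * d)
    (hzc : ∀ (B : Fin 2 → Matrix (Fin k) (Fin k) ℂ) (i : Fin 2), evM B z * B i = B i * evM B z)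
    (hreg : ∀ (ζ : ℂ) (q : NCP), IsId k ((z - algebraMap ℂ NCP ζ) * q) → IsId k q)
    {j : ℕ} (hgj : g ≤ j) (hj : j ≤ 2 * d) :
    Module.finrank ℂ ((Pd⟦j⟧).map (evM A).toLinearMap) + genericWordDim k (j - g) ≤ genericWordDim k j := by
  haveI := finiteDimensional_Pd j
  haveI := finiteDimensional_Pd (j - g)
  obtain ⟨ζ, hζ⟩ := eval_central_eq_smul_one hspan hwin hz hgd hzc
  set c : NCP := z - algebraMap ℂ NCP ζ with hc
  have hcA : evM A c = 0 := by
    rw [hc, map_sub, hζ, AlgHom.commutes, Algebra.algebraMap_eq_smul_one, sub_self]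
  -- the restricted maps
  let fA : Pd⟦j⟧ →ₗ[ℂ] Matrix (Fin n) (Fin n) ℂ := (evM A).toLinearMap.domRestrict (Pd⟦j⟧)
  let fE : Pd⟦j⟧ →ₗ[ℂ] ((Fin 2 → Matrix (Fin k) (Fin k) ℂ) → Matrix (Fin k) (Fin k) ℂ) :=
    (evF⟦k⟧).domRestrict (Pd⟦j⟧)
  let fE' : Pd⟦j - g⟧ →ₗ[ℂ] ((Fin 2 → Matrix (Fin k) (Fin k) ℂ) → Matrix (Fin k) (Fin k) ℂ) :=
    (evF⟦k⟧).domRestrict (Pd⟦j - g⟧)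
  have hmulU : ∀ q : Pd⟦j - g⟧, c * (q : NCP) ∈ Pd⟦j⟧ := by
    intro q
    have h1 : c ∈ Pd⟦g⟧ := Submodule.sub_mem _ hz (algebraMap_mem_Pd ζ g)
    have := mul_mem_Pd h1 q.2
    rwa [Nat.add_sub_cancel' hgj] at this
  let μ : Pd⟦j - g⟧ →ₗ[ℂ] Pd⟦j⟧ :=
    LinearMap.codRestrict (Pd⟦j⟧) ((LinearMap.mulLeft ℂ c).domRestrict (Pd⟦j - g⟧)) hmulU
  have hμ : ∀ q : Pd⟦j - g⟧, ((μ q : Pd⟦j⟧) : NCP) = c * q := fun q => rfl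
  -- translations
  have hfE : ∀ q : Pd⟦j⟧, fE q = 0 ↔ IsId k (q : NCP) := fun q => evF_eq_zero_iff
  have hfE' : ∀ q : Pd⟦j - g⟧, fE' q = 0 ↔ IsId k (q : NCP) := fun q => evF_eq_zero_iff
  -- (s1) both pieces lie in the kernel of evaluation at `A`
  have s1 : LinearMap.ker fE ⊔ LinearMap.range μ ≤ LinearMap.ker fA := by
    refine sup_le ?_ ?_
    · intro q hq
      rw [LinearMap.mem_ker] at hq ⊢
      exact window_poly hwin (Pd_mono hj q.2) ((hfE q).1 hq)
    · rintro _ ⟨q, rfl⟩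
      rw [LinearMap.mem_ker]
      change evM A ((μ q : Pd⟦j⟧) : NCP) = 0
      rw [hμ, map_mul, hcA, zero_mul]
  -- (s2) regularity: the identities inside the image of `μ` come from identities
  have s2 : LinearMap.ker fE ⊓ LinearMap.range μ = (LinearMap.ker fE').map μ := by
    ext x
    constructor
    · rintro ⟨hx, q, rfl⟩
      refine ⟨q, ?_, rfl⟩
      have hx' : fE (μ q) = 0 := by simpa using hx
      show q ∈ LinearMap.ker fE'
      rw [LinearMap.mem_ker, hfE']
      apply hreg ζ
      rw [← hc, ← hμ]
      exact (hfE _).1 hx'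
    · rintro ⟨q, hq, rfl⟩
      have hq' : IsId k (q : NCP) := by
        have : q ∈ LinearMap.ker fE' := by simpa using hq
        rw [LinearMap.mem_ker, hfE'] at this
        exact this
      refine ⟨?_, q, rfl⟩
      show μ q ∈ LinearMap.ker fE
      rw [LinearMap.mem_ker, hfE, hμ]
      intro B
      rw [map_mul, hq' B, mul_zero]
  -- (s3) the kernel of `μ` consists of identities (indeed it is trivial)
  have s3 : LinearMap.ker μ ≤ LinearMap.ker fE' := by
    intro q hq
    rw [LinearMap.mem_ker] at hq
    rw [LinearMap.mem_ker, hfE']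
    apply hreg ζ
    rw [← hc, ← hμ, hq]
    intro B
    simp
  -- dimension bookkeeping
  have e1 := LinearMap.finrank_range_add_finrank_ker fA
  have e2 := LinearMap.finrank_range_add_finrank_ker fE
  have e6 := LinearMap.finrank_range_add_finrank_ker fE'
  have e5 := LinearMap.finrank_range_add_finrank_ker (K := ℂ) μ
  let μ' : LinearMap.ker fE' →ₗ[ℂ] Pd⟦j⟧ := μ.domRestrict (LinearMap.ker fE')
  have e7 := @LinearMap.finrank_range_add_finrank_ker ℂ (LinearMap.ker fE') _ _ _ (Pd⟦j⟧) _ _ _ μ'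
  have e3 := Submodule.finrank_sup_add_finrank_inf_eq (LinearMap.ker fE) (LinearMap.range μ)
  have e4 : Module.finrank ℂ ↥(LinearMap.ker fE ⊔ LinearMap.range μ) ≤
      Module.finrank ℂ (LinearMap.ker fA) := Submodule.finrank_mono s1
  have e8 : Module.finrank ℂ ↥(LinearMap.ker fE ⊓ LinearMap.range μ) =
      Module.finrank ℂ (LinearMap.range μ') := by
    rw [s2, show LinearMap.range μ' = (LinearMap.ker fE').map μ from range_domRestrict_eq_map _ _]
  have e9 : Module.finrank ℂ (LinearMap.ker μ') =
      Module.finrank ℂ (LinearMap.ker μ) := by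
    rw [show LinearMap.ker μ' = (LinearMap.ker μ).comap (LinearMap.ker fE').subtype from
      LinearMap.ker_domRestrict _ _]
    exact (Submodule.comapSubtypeEquivOfLe s3).finrank_eq
  have hrA : Module.finrank ℂ (LinearMap.range fA) =
      Module.finrank ℂ ((Pd⟦j⟧).map (evM A).toLinearMap) := by
    rw [range_domRestrict_eq_map]
  have hrE : Module.finrank ℂ (LinearMap.range fE) = genericWordDim k j := by
    rw [range_domRestrict_eq_map, wordDim_eq]
  have hrE' : Module.finrank ℂ (LinearMap.range fE') = genericWordDim k (j - g) := by
    rw [range_domRestrict_eq_map, wordDim_eq]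
  omega

end TightWindowsLoose

end Summit.MatrixMultiplication.MatrixMultiplication.Theorems
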